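import Summits.BirchSwinnertonDyer.Rank1Residual.Additive.RamifiedSevenGenusGaloisTransport
import HarnessLib

set_option autoImplicit false

/-!
# `𝒞₇` genus road (crux `EllipticUnitValueSevenOfGZK`, K7r), the (5)-unit programme (SUMMON GENUS-UNIT-A5), File B2b:
# THE TWO SUM CONVERSIONS — `Σ_{τ ∈ Gal(K(𝔪)/K)} χ_K(τ) log‖ι̂ τy‖ = #Stab · Σ_{g ∈ Gal(L/ℚ), g|_{e(K)} = id} χ(g) log‖Φ g(ey)‖`
# along the pin's `e`, and the conjugation halving `Σ_{g ∈ Gal(L/ℚ)} = 2·Σ_{g|_{e(K)} = id}` for even readings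
# (memo S5 (a)/(b3); THEOREMS ONLY)

Cell bsd-cm, seat bsd-cm-k-ty1 g26 (literature-prover); ruled memo `pub/bsd-cm/bsd-cm-k-ty1/g26/G45-typing-memo.md`
(c225f82434dc25c5; pen D941/D948/D950).  `E = K(𝔪) ⊂ K̄` a ray class field, `L ⊂ ℚ̄` a normal subfield with `e(K) ⊆ L ⊆ e(E)`
(`L = F′ₙ`, `E = K(7^{n+1}𝔣)`), `M = e⁻¹(L)`, `Φ : ℚ̄ → ℂ` with `Φ ∘ e = ι̂` (B2a).  All statements are GENERAL (any number field
`K`, any such `e`, `L`); no definition (the transport `τ ↦ σ_τ|_L` is built INSIDE the proofs from B2a's `exists_absGal_extends`,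
with kernel `Gal(E/M)` and range `{g : g|_{e(K)} = id}`), no named fact, no instance.

* §1 `galoisLogSum_eq_card_mul_finsum` ★ — for characters `χ_K` of `Gal(E/K)` and `χ` of `Gal(L/ℚ)` COMPATIBLE THROUGH `e`
  (`hcomp`: whenever `g` and `τ` agree through `e` on `e⁻¹(L)`, `χ_K τ = χ g`) and `y ∈ E` with `e y ∈ L`:
  `galoisLogSum 𝔪 χ_K ι̂ y = #Gal(E/M) · ∑ᶠ g ∈ {g | g fixes e(K)}, χ(g)·log‖Φ(g·ey)‖`.
* §2 `normCharacter_eq_of_reading` — the compatibility for `χ_K = ψ ∘ χ_cyc` (p784195's norm character at a primitive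
  `m`-th root `ζ ∈ E`) from the DIRICHLET READING of `χ` (pen D950's literal shape):
  `∀ σ g a, (∀ y, (g y : ℚ̄) = σ y) → σ (e ζ) = (e ζ)^a → χ g = ψ a`; and ★ `galoisLogSum_normCharacter_eq_card_mul_finsum`.
* §3 `complexConjugation_mul_self`, `norm_map_complexConjugation` and ★ `finsum_eq_two_mul_finsum_fixes` — for `[K:ℚ] = 2`,
  `s² = −7`, a complex conjugation `c` (`Φ ∘ c = conj ∘ Φ`) and a character `χ` of `Gal(L/ℚ)` with `χ(c|_L) = 1`:
  `∑ᶠ g, χ(g) log‖Φ(g x)‖ = 2 · ∑ᶠ g ∈ {g fixes e(K)}, χ(g) log‖Φ(g x)‖`; `character_conj_eq_one_of_even` — THE EVENNESS LINE: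
  under the Dirichlet reading at a root of unity, `χ(c|_L) = ψ(−1)`, `= 1` for even `ψ`.

HONEST LABEL: general bookkeeping; nothing closes; stmt-BirchSwinnertonDyer-19945 OPEN; K1ᵘ NOT proved; `X12.CMRamifiedSeven` NOT
proved; BSD is claimed for no curve; no summit statement is proved by this seat.

## References
* K. Kato, Astérisque 295 (2004) §15.5 (15.5.1) (p. 253), §15.14 (p. 264) [Kato2004Asterisque].
* G. Shimura, *Abelian Varieties with Complex Multiplication and Modular Functions* (1998) §8.1 [Shimura1998].
* J. Neukirch, *Algebraic Number Theory* (1999) Ch. IV §1 [NeukirchANT1999].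
* Tree: B2a `RamifiedSevenGenusGaloisTransport.lean`, B1 `RamifiedSevenGenusKatoSideLevelIdentity.lean` (p787265), p784195
  `NormCharacterArtinSymbol.lean` (`normCharacter_apply_of_apply_eq_pow`), `KroneckerLimitFormula.lean` (`galoisLogSum`).
-/

noncomputable section

open scoped NumberField ComplexConjugate
open IsDedekindDomain NumberField
open Literature.NumberTheory.NumberFields (rayClassField)
open Literature.NumberTheory.ComplexMultiplication.EllipticUnits

namespace Summit.BirchSwinnertonDyer.Rank1Residual.Additive.GenusSeven

variable {K : Type} [Field K] [NumberField K]

/-! ## §0 Two counting lemmas for a homomorphism of finite groups -/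

section Counting

/-- The fibre of `T` over `T τ₀` has the cardinality of `ker T` (`τ ↦ τ₀⁻¹τ`). [cite: NeukirchANT1999, Ch. IV §1] -/
private theorem card_filter_eq_card_filter_ker {G H : Type*} [Group G] [Fintype G] [DecidableEq G] [Group H]
    [DecidableEq H] (T : G →* H) (τ₀ : G) :
    (Finset.univ.filter fun τ => T τ = T τ₀).card = (Finset.univ.filter fun τ => τ ∈ T.ker).card := by
  refine Finset.card_bij (fun τ _ => τ₀⁻¹ * τ) (fun τ hτ => ?_) (fun τ₁ _ τ₂ _ h => mul_left_cancel h)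
    (fun ρ hρ => ⟨τ₀ * ρ, ?_, ?_⟩)
  · simp only [Finset.mem_filter, Finset.mem_univ, true_and] at hτ ⊢
    rw [MonoidHom.mem_ker, map_mul, map_inv, hτ, inv_mul_cancel]
  · simp only [Finset.mem_filter, Finset.mem_univ, true_and, MonoidHom.mem_ker] at hρ ⊢
    rw [map_mul, hρ, mul_one]
  · rw [inv_mul_cancel_left]

/-- `Σ_τ f(T τ) = #ker T · Σ_{g ∈ T(G)} f(g)`. [cite: NeukirchANT1999, Ch. IV §1] -/
private theorem sum_comp_eq_card_ker_mul {G H : Type*} [Group G] [Fintype G] [DecidableEq G] [Group H] [DecidableEq H]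
    (T : G →* H) (f : H → ℂ) :
    ∑ τ, f (T τ) = ((Finset.univ.filter fun τ => τ ∈ T.ker).card : ℂ) * ∑ g ∈ Finset.univ.image T, f g := by
  rw [Finset.sum_comp, Finset.mul_sum]
  refine Finset.sum_congr rfl fun g hg => ?_
  obtain ⟨τ₀, -, rfl⟩ := Finset.mem_image.mp hg
  rw [card_filter_eq_card_filter_ker T τ₀, nsmul_eq_mul]

end Counting

/-- Restriction to a normal intermediate field, read in `ℚ̄` (Mathlib's `AlgEquiv.restrictNormal_commutes` with the
`IntermediateField` coercion in place of `algebraMap`). [cite: NeukirchANT1999, Ch. IV §1] -/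
theorem coe_restrictNormal_apply (L : IntermediateField ℚ (AlgebraicClosure ℚ)) [Normal ℚ L]
    (σ : AlgebraicClosure ℚ ≃ₐ[ℚ] AlgebraicClosure ℚ) (x : L) :
    ((σ.restrictNormal L x : L) : AlgebraicClosure ℚ) = σ (x : AlgebraicClosure ℚ) := by
  have h := AlgEquiv.restrictNormal_commutes σ L x
  rwa [IntermediateField.algebraMap_apply, IntermediateField.algebraMap_apply] at h

/-! ## §1 From `Gal(K(𝔪)/K)` to `Gal(L/ℚ)` along `e`: the character sum of a transported element -/

section Conversion

variable {𝔪 : Ideal (𝓞 K)}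

/-- ★ **THE K-SIDE ⟶ ℚ̄-SIDE CONVERSION.**  `E = K(𝔪)`, `L ⊂ ℚ̄` normal with `e(K) ⊆ L ⊆ e(E)`, `M = e⁻¹(L)`,
`Φ ∘ e = ι̂`; `χ_K` a character of `Gal(E/K)` and `χ` a character of `Gal(L/ℚ)` COMPATIBLE THROUGH `e`; `y ∈ E` with `e y ∈ L`.
Then `Σ_{τ ∈ Gal(E/K)} χ_K(τ)·log‖ι̂(τ y)‖ = #Gal(E/M) · Σ_{g ∈ Gal(L/ℚ), g|_{e(K)} = id} χ(g)·log‖Φ(g (e y))‖`: the map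
`τ ↦ σ_τ|_L` (`σ_τ ∈ Gal(ℚ̄/ℚ)` any `e`-conjugate of `τ`, B2a) is a homomorphism with kernel `Gal(E/M)` and range the
automorphisms fixing `e(K)`.  Memo S5 (a) (second half). [cite: Kato2004Asterisque, §15.14 (p. 264, the two towers)]
[cite: NeukirchANT1999, Ch. IV §1] -/
theorem galoisLogSum_eq_card_mul_finsum (e : AlgebraicClosure K →+* AlgebraicClosure ℚ)
    (L : IntermediateField ℚ (AlgebraicClosure ℚ)) [Normal ℚ L]
    (hKL : ∀ k : K, e (algebraMap K (AlgebraicClosure K) k) ∈ L)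
    (hcov : ∀ x : AlgebraicClosure ℚ, x ∈ L → ∃ y : AlgebraicClosure K, y ∈ rayClassField K 𝔪 ∧ e y = x)
    {Φ : AlgebraicClosure ℚ →+* ℂ} {ι' : AlgebraicClosure K →+* ℂ} (hΦ : ∀ y : AlgebraicClosure K, Φ (e y) = ι' y)
    (χK : (rayClassField K 𝔪 ≃ₐ[K] rayClassField K 𝔪) →* ℂˣ) (χ : (L ≃ₐ[ℚ] L) →* ℂˣ)
    (hcomp : ∀ (τ : rayClassField K 𝔪 ≃ₐ[K] rayClassField K 𝔪) (g : L ≃ₐ[ℚ] L),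
      (∀ (y : rayClassField K 𝔪) (hy : e (y : AlgebraicClosure K) ∈ L),
        ((g ⟨e (y : AlgebraicClosure K), hy⟩ : L) : AlgebraicClosure ℚ) = e ((τ y : rayClassField K 𝔪) : AlgebraicClosure K)) →
      χK τ = χ g)
    (y : rayClassField K 𝔪) (hy : e (y : AlgebraicClosure K) ∈ L) :
    galoisLogSum 𝔪 χK ι' y =
      (Nat.card (galOver (rayClassField K 𝔪) (preimageField e L hKL)) : ℂ) *
        ∑ᶠ g ∈ {g : L ≃ₐ[ℚ] L | ∀ k : K,
            ((g ⟨e (algebraMap K (AlgebraicClosure K) k), hKL k⟩ : L) : AlgebraicClosure ℚ) =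
              e (algebraMap K (AlgebraicClosure K) k)},
          ((χ g : ℂˣ) : ℂ) * (Real.log ‖Φ ((g ⟨e (y : AlgebraicClosure K), hy⟩ : L) : AlgebraicClosure ℚ)‖ : ℂ) := by
  classical
  haveI : IsAlgClosure ℚ (AlgebraicClosure ℚ) := isAlgClosure_rat_algebraicClosure
  haveI : Normal ℚ (AlgebraicClosure ℚ) := IsAlgClosure.normal ℚ _
  -- the transport `τ ↦ σ_τ|_L`
  choose σ hσ using fun τ : rayClassField K 𝔪 ≃ₐ[K] rayClassField K 𝔪 => exists_absGal_extends e (rayClassField K 𝔪) τ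
  have hTf : ∀ (τ : rayClassField K 𝔪 ≃ₐ[K] rayClassField K 𝔪) (w : rayClassField K 𝔪)
      (hw : e (w : AlgebraicClosure K) ∈ L),
      ((((σ τ).restrictNormal L) ⟨e (w : AlgebraicClosure K), hw⟩ : L) : AlgebraicClosure ℚ) =
        e ((τ w : rayClassField K 𝔪) : AlgebraicClosure K) := fun τ w hw => by
    rw [coe_restrictNormal_apply]; exact hσ τ w
  -- every `x ∈ L` is `e w`, `w ∈ E`
  have hcov' : ∀ x : L, ∃ w : rayClassField K 𝔪, e (w : AlgebraicClosure K) = (x : AlgebraicClosure ℚ) := fun x => by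
    obtain ⟨w, hwE, hwx⟩ := hcov x x.2
    exact ⟨⟨w, hwE⟩, hwx⟩
  have hTmul : ∀ τ₁ τ₂ : rayClassField K 𝔪 ≃ₐ[K] rayClassField K 𝔪,
      (σ (τ₁ * τ₂)).restrictNormal L = (σ τ₁).restrictNormal L * (σ τ₂).restrictNormal L := by
    intro τ₁ τ₂
    apply AlgEquiv.ext
    intro x
    apply Subtype.ext
    obtain ⟨w, hw⟩ := hcov' x
    have hx : x = ⟨e (w : AlgebraicClosure K), hw ▸ x.2⟩ := Subtype.ext hw.symm
    rw [hx, AlgEquiv.mul_apply, hTf, AlgEquiv.mul_apply]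
    have h2 : ((σ τ₂).restrictNormal L) ⟨e (w : AlgebraicClosure K), hw ▸ x.2⟩ =
        ⟨e ((τ₂ w : rayClassField K 𝔪) : AlgebraicClosure K), by rw [← hTf τ₂ w (hw ▸ x.2)]; exact Subtype.mem _⟩ :=
      Subtype.ext (hTf τ₂ w _)
    rw [h2, hTf]
  let T : (rayClassField K 𝔪 ≃ₐ[K] rayClassField K 𝔪) →* (L ≃ₐ[ℚ] L) :=
    MonoidHom.mk' (fun τ => (σ τ).restrictNormal L) hTmul
  have hT : ∀ τ, T τ = (σ τ).restrictNormal L := fun τ => rfl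
  -- termwise identification
  have hterm : ∀ τ : rayClassField K 𝔪 ≃ₐ[K] rayClassField K 𝔪,
      ((χK τ : ℂˣ) : ℂ) * (Real.log ‖ι' ((τ y : rayClassField K 𝔪) : AlgebraicClosure K)‖ : ℂ) =
        ((χ (T τ) : ℂˣ) : ℂ) * (Real.log ‖Φ ((T τ ⟨e (y : AlgebraicClosure K), hy⟩ : L) : AlgebraicClosure ℚ)‖ : ℂ) := by
    intro τ
    rw [hcomp τ (T τ) (fun w hw => by rw [hT, hTf]), hT, hTf, hΦ]
  -- the kernel is `Gal(E/M)`
  have hker : ∀ τ : rayClassField K 𝔪 ≃ₐ[K] rayClassField K 𝔪,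
      τ ∈ T.ker ↔ τ ∈ galOver (rayClassField K 𝔪) (preimageField e L hKL) := by
    intro τ
    rw [MonoidHom.mem_ker, hT]
    constructor
    · intro h w hwE hwM
      rw [mem_preimageField_iff] at hwM
      apply e.injective
      have h1 := hTf τ ⟨w, hwE⟩ hwM
      rw [h, AlgEquiv.one_apply] at h1
      exact h1.symm
    · intro h
      apply AlgEquiv.ext
      intro x
      apply Subtype.ext
      obtain ⟨w, hw⟩ := hcov' x
      have hx : x = ⟨e (w : AlgebraicClosure K), hw ▸ x.2⟩ := Subtype.ext hw.symm
      rw [hx, hTf, AlgEquiv.one_apply]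
      exact congrArg e (h (w : AlgebraicClosure K) w.2 (by rw [mem_preimageField_iff]; exact hw ▸ x.2))
  -- the range is the set of automorphisms fixing `e(K)`
  have hrange : (↑(Finset.univ.image T) : Set (L ≃ₐ[ℚ] L)) = {g : L ≃ₐ[ℚ] L | ∀ k : K,
      ((g ⟨e (algebraMap K (AlgebraicClosure K) k), hKL k⟩ : L) : AlgebraicClosure ℚ) =
        e (algebraMap K (AlgebraicClosure K) k)} := by
    ext g
    simp only [Finset.coe_image, Finset.coe_univ, Set.image_univ, Set.mem_range, Set.mem_setOf_eq]
    constructor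
    · rintro ⟨τ, rfl⟩ k
      have h := hTf τ (algebraMap K (rayClassField K 𝔪) k) (hKL k)
      simp only [AlgEquiv.commutes] at h
      rw [hT]
      exact h
    · intro hg
      obtain ⟨σ', hσ'⟩ := AlgEquiv.restrictNormalHom_surjective (F := ℚ) (E := AlgebraicClosure ℚ) (K₁ := L) g
      have hrN : AlgEquiv.restrictNormalHom L σ' = σ'.restrictNormal L := rfl
      rw [hrN] at hσ'
      have hσ'K : ∀ k : K, σ' (e (algebraMap K (AlgebraicClosure K) k)) = e (algebraMap K (AlgebraicClosure K) k) := by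
        intro k
        have h1 := hg k
        rw [← hσ', coe_restrictNormal_apply] at h1
        exact h1
      obtain ⟨τ, hτ⟩ := exists_gal_of_forall_apply_eq e (rayClassField K 𝔪) σ' hσ'K
      refine ⟨τ, AlgEquiv.ext fun x => Subtype.ext ?_⟩
      obtain ⟨w, hw⟩ := hcov' x
      have hx : x = ⟨e (w : AlgebraicClosure K), hw ▸ x.2⟩ := Subtype.ext hw.symm
      rw [hx, hT, hTf, ← hτ w, ← hσ', coe_restrictNormal_apply]
  -- count
  have hcard : ((Finset.univ.filter fun τ => τ ∈ T.ker).card : ℂ) =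
      (Nat.card (galOver (rayClassField K 𝔪) (preimageField e L hKL)) : ℂ) := by
    rw [Nat.card_coe_set_eq, Set.ncard_eq_toFinset_card']
    congr 2
    ext τ
    simp only [Finset.mem_filter, Finset.mem_univ, true_and, Set.mem_toFinset]
    exact hker τ
  rw [galoisLogSum, finsum_eq_sum_of_fintype, Finset.sum_congr rfl (fun τ _ => hterm τ),
    sum_comp_eq_card_ker_mul T (fun g => ((χ g : ℂˣ) : ℂ) *
      (Real.log ‖Φ ((g ⟨e (y : AlgebraicClosure K), hy⟩ : L) : AlgebraicClosure ℚ)‖ : ℂ)),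
    hcard, ← finsum_mem_coe_finset, hrange]

end Conversion

/-! ## §2 The compatibility for the norm characters `ψ ∘ χ_cyc` from a Dirichlet reading -/

section Reading

variable {𝔪 : Ideal (𝓞 K)} {m : ℕ} [NeZero m]

/-- **From a DIRICHLET READING of `χ` to the compatibility with `ψ ∘ χ_cyc`**: if `χ(g) = ψ(a)` whenever `g = σ|_L` and
`σ (e ζ) = (e ζ)^a` (`ζ ∈ K(𝔪)` a primitive `m`-th root of unity), then `χ` and p784195's norm character `ψ ∘ χ_cyc` (read at
`ζ`) are compatible through `e` — readings travel along `e` (B2a `apply_eq_pow_of_extends`).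
[cite: Kato2004Asterisque, §15.14 (p. 264)] [cite: NeukirchANT1999, Ch. VI §1 (the cyclotomic character)] -/
theorem normCharacter_eq_of_reading (e : AlgebraicClosure K →+* AlgebraicClosure ℚ)
    (L : IntermediateField ℚ (AlgebraicClosure ℚ))
    (hcov : ∀ x : AlgebraicClosure ℚ, x ∈ L → ∃ y : AlgebraicClosure K, y ∈ rayClassField K 𝔪 ∧ e y = x)
    {ζ : rayClassField K 𝔪} (hζ : IsPrimitiveRoot ζ m) (ψ : DirichletCharacter ℂ m) (χ : (L ≃ₐ[ℚ] L) →* ℂˣ)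
    (hread : ∀ (σ : AlgebraicClosure ℚ ≃ₐ[ℚ] AlgebraicClosure ℚ) (g : L ≃ₐ[ℚ] L) (a : ℕ),
      (∀ x : L, ((g x : L) : AlgebraicClosure ℚ) = σ x) →
      σ (e (ζ : AlgebraicClosure K)) = e (ζ : AlgebraicClosure K) ^ a → χ g = ψ a)
    (τ : rayClassField K 𝔪 ≃ₐ[K] rayClassField K 𝔪) (g : L ≃ₐ[ℚ] L)
    (hg : ∀ (y : rayClassField K 𝔪) (hy : e (y : AlgebraicClosure K) ∈ L),
      ((g ⟨e (y : AlgebraicClosure K), hy⟩ : L) : AlgebraicClosure ℚ) = e ((τ y : rayClassField K 𝔪) : AlgebraicClosure K)) :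
    (ψ.toUnitHom.comp (hζ.autToPow K)) τ = χ g := by
  obtain ⟨σ, hσ⟩ := exists_absGal_extends e (rayClassField K 𝔪) τ
  have hgσ : ∀ x : L, ((g x : L) : AlgebraicClosure ℚ) = σ x := fun x => by
    obtain ⟨w, hwE, hwx⟩ := hcov x x.2
    have hx : x = ⟨e w, hwx ▸ x.2⟩ := Subtype.ext hwx.symm
    rw [hx, hg ⟨w, hwE⟩, ← hσ ⟨w, hwE⟩]
  have ha : τ ζ = ζ ^ (hζ.autToPow K τ : ZMod m).val := (hζ.autToPow_spec K τ).symm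
  have hχ := hread σ g _ hgσ (apply_eq_pow_of_extends hσ ha)
  apply Units.ext
  rw [normCharacter_apply_of_apply_eq_pow hζ ψ τ ha, hχ]

/-- ★ **The conversion for the norm characters**: under the Dirichlet reading of `χ` at `e ζ`,
`galoisLogSum 𝔪 (ψ ∘ χ_cyc) ι̂ y = #Gal(E/M) · ∑ᶠ_{g fixes e(K)} χ(g)·log‖Φ(g (e y))‖` for every `y ∈ K(𝔪)` with `e y ∈ L`
(§1 + `normCharacter_eq_of_reading`).  Memo S5 (a) at the genus characters. [cite: Kato2004Asterisque, §15.5 (15.5.1) (p. 253) and §15.14 (p. 264)] -/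
theorem galoisLogSum_normCharacter_eq_card_mul_finsum (e : AlgebraicClosure K →+* AlgebraicClosure ℚ)
    (L : IntermediateField ℚ (AlgebraicClosure ℚ)) [Normal ℚ L]
    (hKL : ∀ k : K, e (algebraMap K (AlgebraicClosure K) k) ∈ L)
    (hcov : ∀ x : AlgebraicClosure ℚ, x ∈ L → ∃ y : AlgebraicClosure K, y ∈ rayClassField K 𝔪 ∧ e y = x)
    {Φ : AlgebraicClosure ℚ →+* ℂ} {ι' : AlgebraicClosure K →+* ℂ} (hΦ : ∀ y : AlgebraicClosure K, Φ (e y) = ι' y)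
    {ζ : rayClassField K 𝔪} (hζ : IsPrimitiveRoot ζ m) (ψ : DirichletCharacter ℂ m) (χ : (L ≃ₐ[ℚ] L) →* ℂˣ)
    (hread : ∀ (σ : AlgebraicClosure ℚ ≃ₐ[ℚ] AlgebraicClosure ℚ) (g : L ≃ₐ[ℚ] L) (a : ℕ),
      (∀ x : L, ((g x : L) : AlgebraicClosure ℚ) = σ x) →
      σ (e (ζ : AlgebraicClosure K)) = e (ζ : AlgebraicClosure K) ^ a → χ g = ψ a)
    (y : rayClassField K 𝔪) (hy : e (y : AlgebraicClosure K) ∈ L) :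
    galoisLogSum 𝔪 (ψ.toUnitHom.comp (hζ.autToPow K)) ι' y =
      (Nat.card (galOver (rayClassField K 𝔪) (preimageField e L hKL)) : ℂ) *
        ∑ᶠ g ∈ {g : L ≃ₐ[ℚ] L | ∀ k : K,
            ((g ⟨e (algebraMap K (AlgebraicClosure K) k), hKL k⟩ : L) : AlgebraicClosure ℚ) =
              e (algebraMap K (AlgebraicClosure K) k)},
          ((χ g : ℂˣ) : ℂ) * (Real.log ‖Φ ((g ⟨e (y : AlgebraicClosure K), hy⟩ : L) : AlgebraicClosure ℚ)‖ : ℂ) :=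
  galoisLogSum_eq_card_mul_finsum e L hKL hcov hΦ _ χ
    (fun τ g hg => normCharacter_eq_of_reading e L hcov hζ ψ χ hread τ g hg) y hy

end Reading

/-! ## §3 The conjugation halving `Σ_{Gal(L/ℚ)} = 2·Σ_{Gal(L/e(K))}` for even readings -/

section Halving

/-- `c² = 1` for a complex conjugation `c` (`Φ (c (c x)) = conj (conj (Φ x)) = Φ x`). [cite: Shimura1998, §8.1] -/
theorem complexConjugation_mul_self {Φ : AlgebraicClosure ℚ →+* ℂ} {c : AlgebraicClosure ℚ ≃ₐ[ℚ] AlgebraicClosure ℚ}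
    (hc : ∀ x : AlgebraicClosure ℚ, Φ (c x) = conj (Φ x)) : c * c = 1 := by
  apply AlgEquiv.ext
  intro x
  apply Φ.injective
  rw [AlgEquiv.mul_apply, hc, hc, Complex.conj_conj, AlgEquiv.one_apply]

/-- `‖Φ (c x)‖ = ‖Φ x‖`. [cite: Shimura1998, §8.1] -/
theorem norm_map_complexConjugation {Φ : AlgebraicClosure ℚ →+* ℂ} {c : AlgebraicClosure ℚ ≃ₐ[ℚ] AlgebraicClosure ℚ}
    (hc : ∀ x : AlgebraicClosure ℚ, Φ (c x) = conj (Φ x)) (x : AlgebraicClosure ℚ) : ‖Φ (c x)‖ = ‖Φ x‖ := by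
  rw [hc, Complex.norm_conj]

/-- ★ **THE CONJUGATION HALVING** (memo S5 (b3)): `[K : ℚ] = 2`, `s² = −7`, `e(K) ⊆ L ⊂ ℚ̄` normal and finite, `c` a complex
conjugation for `Φ` (`Φ ∘ c = conj ∘ Φ`, so `c (e s) = −e s`), `χ` a character of `Gal(L/ℚ)` with `χ(c|_L) = 1`.  Then for every
`x ∈ L`: `Σ_{g ∈ Gal(L/ℚ)} χ(g)·log‖Φ(g x)‖ = 2 · Σ_{g ∈ Gal(L/ℚ), g|_{e(K)} = id} χ(g)·log‖Φ(g x)‖` — `Gal(L/ℚ)` is the disjoint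
union of the automorphisms fixing `e(K)` and their `c`-translates, and `log‖Φ(c·g x)‖ = log‖conj Φ(g x)‖ = log‖Φ(g x)‖`.
[cite: Shimura1998, §8.1] [cite: Kato2004Asterisque, §15.14 (p. 264)] -/
theorem finsum_eq_two_mul_finsum_fixes (hK2 : Module.finrank ℚ K = 2) {s : K} (hs : s ^ 2 = -7)
    (e : AlgebraicClosure K →+* AlgebraicClosure ℚ) (L : IntermediateField ℚ (AlgebraicClosure ℚ)) [Normal ℚ L]
    [FiniteDimensional ℚ L] (hKL : ∀ k : K, e (algebraMap K (AlgebraicClosure K) k) ∈ L)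
    {Φ : AlgebraicClosure ℚ →+* ℂ} {c : AlgebraicClosure ℚ ≃ₐ[ℚ] AlgebraicClosure ℚ}
    (hc : ∀ x : AlgebraicClosure ℚ, Φ (c x) = conj (Φ x))
    (hcs : c (e (algebraMap K (AlgebraicClosure K) s)) = -e (algebraMap K (AlgebraicClosure K) s))
    (χ : (L ≃ₐ[ℚ] L) →* ℂˣ) (hχc : χ (c.restrictNormal L) = 1) (x : L) :
    ∑ᶠ g : L ≃ₐ[ℚ] L, ((χ g : ℂˣ) : ℂ) * (Real.log ‖Φ ((g x : L) : AlgebraicClosure ℚ)‖ : ℂ) =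
      2 * ∑ᶠ g ∈ {g : L ≃ₐ[ℚ] L | ∀ k : K,
            ((g ⟨e (algebraMap K (AlgebraicClosure K) k), hKL k⟩ : L) : AlgebraicClosure ℚ) =
              e (algebraMap K (AlgebraicClosure K) k)},
          ((χ g : ℂˣ) : ℂ) * (Real.log ‖Φ ((g x : L) : AlgebraicClosure ℚ)‖ : ℂ) := by
  classical
  haveI : IsAlgClosure ℚ (AlgebraicClosure ℚ) := isAlgClosure_rat_algebraicClosure
  haveI : Normal ℚ (AlgebraicClosure ℚ) := IsAlgClosure.normal ℚ _
  -- the predicate «fixes e(K)» and its behaviour under `c|_L`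
  let P : (L ≃ₐ[ℚ] L) → Prop := fun g => ∀ k : K,
    ((g ⟨e (algebraMap K (AlgebraicClosure K) k), hKL k⟩ : L) : AlgebraicClosure ℚ) = e (algebraMap K (AlgebraicClosure K) k)
  set cL : L ≃ₐ[ℚ] L := c.restrictNormal L with hcL
  have hlift : ∀ g : L ≃ₐ[ℚ] L, ∃ σ : AlgebraicClosure ℚ ≃ₐ[ℚ] AlgebraicClosure ℚ, ∀ z : L,
      ((g z : L) : AlgebraicClosure ℚ) = σ z := fun g => by
    obtain ⟨σ, hσ⟩ := AlgEquiv.restrictNormalHom_surjective (F := ℚ) (E := AlgebraicClosure ℚ) (K₁ := L) g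
    have hrN : AlgEquiv.restrictNormalHom L σ = σ.restrictNormal L := rfl
    rw [hrN] at hσ
    exact ⟨σ, fun z => by rw [← hσ, coe_restrictNormal_apply]⟩
  have hPiff : ∀ g : L ≃ₐ[ℚ] L, P (cL * g) ↔ ¬ P g := by
    intro g
    obtain ⟨σ, hσ⟩ := hlift g
    have hPg : P g ↔ ∀ k : K, σ (e (algebraMap K (AlgebraicClosure K) k)) = e (algebraMap K (AlgebraicClosure K) k) :=
      forall_congr' fun k => by rw [hσ]
    have hPcg : P (cL * g) ↔
        ∀ k : K, (c * σ) (e (algebraMap K (AlgebraicClosure K) k)) = e (algebraMap K (AlgebraicClosure K) k) :=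
      forall_congr' fun k => by
        rw [AlgEquiv.mul_apply, AlgEquiv.mul_apply, hcL, coe_restrictNormal_apply, hσ]
    rw [hPg, hPcg]
    constructor
    · intro h1 h2
      exact not_conj_mul_fixes_of_fixes hK2 hs e hcs h2 h1
    · exact conj_mul_fixes_of_not_fixes hK2 hs e hcs
  have hcL2 : ∀ g : L ≃ₐ[ℚ] L, cL * (cL * g) = g := by
    intro g
    apply AlgEquiv.ext
    intro z
    apply Subtype.ext
    rw [AlgEquiv.mul_apply, AlgEquiv.mul_apply, hcL, coe_restrictNormal_apply, coe_restrictNormal_apply, ← AlgEquiv.mul_apply,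
      complexConjugation_mul_self hc, AlgEquiv.one_apply]
  -- the summand is `c`-invariant (THE EVENNESS USE: `χ(c|_L) = 1`, and `‖conj w‖ = ‖w‖`)
  have hG : ∀ g : L ≃ₐ[ℚ] L,
      ((χ (cL * g) : ℂˣ) : ℂ) * (Real.log ‖Φ (((cL * g) x : L) : AlgebraicClosure ℚ)‖ : ℂ) =
        ((χ g : ℂˣ) : ℂ) * (Real.log ‖Φ ((g x : L) : AlgebraicClosure ℚ)‖ : ℂ) := by
    intro g
    rw [map_mul, hχc, one_mul, AlgEquiv.mul_apply, hcL, coe_restrictNormal_apply, norm_map_complexConjugation hc]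
  -- split `Gal(L/ℚ)` into the two cosets
  have hset : {g : L ≃ₐ[ℚ] L | P g} = ↑(Finset.univ.filter P) := by
    ext g; simp
  rw [finsum_eq_sum_of_fintype, hset, finsum_mem_coe_finset,
    ← Finset.sum_filter_add_sum_filter_not Finset.univ P, two_mul]
  congr 1
  refine (Finset.sum_bij (fun g _ => cL * g) (fun g hg => ?_) (fun g₁ _ g₂ _ h => mul_left_cancel h)
    (fun g hg => ⟨cL * g, ?_, hcL2 g⟩) (fun g _ => (hG g).symm)).symm
  · simp only [Finset.mem_filter, Finset.mem_univ, true_and] at hg ⊢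
    exact fun h => (hPiff g).mp h hg
  · simp only [Finset.mem_filter, Finset.mem_univ, true_and] at hg ⊢
    exact (hPiff g).mpr hg

omit [NumberField K] in
/-- **THE EVENNESS LINE**: under the Dirichlet reading of `χ` at a root of unity `e ζ` of order dividing `m`, the complex
conjugation has `χ(c|_L) = ψ(−1)` (`c (e ζ) = (e ζ)⁻¹ = (e ζ)^{m−1}`), hence `= 1` for an EVEN `ψ`.  (Pen D950: «state the
evenness use as one named line».) [cite: Shimura1998, §8.1] [cite: Lang1990, Ch. 3 §5 (even characters)] -/
theorem character_conj_eq_one_of_even (e : AlgebraicClosure K →+* AlgebraicClosure ℚ)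
    (L : IntermediateField ℚ (AlgebraicClosure ℚ)) [Normal ℚ L]
    {Φ : AlgebraicClosure ℚ →+* ℂ} {c : AlgebraicClosure ℚ ≃ₐ[ℚ] AlgebraicClosure ℚ}
    (hc : ∀ x : AlgebraicClosure ℚ, Φ (c x) = conj (Φ x))
    {m : ℕ} [NeZero m] {ζ : AlgebraicClosure K} (hζ : ζ ^ m = 1) (ψ : DirichletCharacter ℂ m) (hψ : ψ.Even)
    (χ : (L ≃ₐ[ℚ] L) →* ℂˣ)
    (hread : ∀ (σ : AlgebraicClosure ℚ ≃ₐ[ℚ] AlgebraicClosure ℚ) (g : L ≃ₐ[ℚ] L) (a : ℕ),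
      (∀ x : L, ((g x : L) : AlgebraicClosure ℚ) = σ x) → σ (e ζ) = e ζ ^ a → χ g = ψ a) :
    χ (c.restrictNormal L) = 1 := by
  have hm : m ≠ 0 := NeZero.ne m
  have hζ' : (e ζ) ^ m = 1 := by rw [← map_pow, hζ, map_one]
  have hc1 : c (e ζ) = e ζ ^ (m - 1) := by
    rw [complexConjugation_apply_of_pow_eq_one hc hm hζ']
    refine inv_eq_of_mul_eq_one_left ?_
    rw [← pow_succ, Nat.sub_add_cancel (Nat.one_le_iff_ne_zero.mpr hm), hζ']
  have h := hread c (c.restrictNormal L) (m - 1) (coe_restrictNormal_apply L c) hc1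
  have hneg : ((m - 1 : ℕ) : ZMod m) = -1 := by
    rw [Nat.cast_sub (Nat.one_le_iff_ne_zero.mpr hm), ZMod.natCast_self, Nat.cast_one, zero_sub]
  rw [hneg, hψ] at h
  exact Units.ext h

end Halving

end Summit.BirchSwinnertonDyer.Rank1Residual.Additive.GenusSeven

end
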